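import Summits.QuantumFields.YangMills.Theorems.FradkinShenkerFlowSusceptibilityToPoincareFineClauseMono
import Summits.QuantumFields.YangMills.Theorems.FradkinShenkerFlowSusceptibilityToPoincareGibbsSparseEfronStein

/-!
# Rider `stub_oneLevelLaw_eq_map` (N1) of the line `rg-variance-cascade` (crux `SusceptibilityToPoincare`)

Route `FradkinShenkerFlow` of `YangMills`, crux item `stmt-QuantumFields-9441`
(`Summit.QuantumFields.YangMills.Theses.FradkinShenkerFlow.SusceptibilityToPoincare`, FS ⇒ UP),
registered skeleton `Cruxes/SusceptibilityToPoincare/Lines/rg_variance_cascade.lean`, rider N1 of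
the necessity package "UP ⇒ TerminalPoincare": **the noise representation of the one-level joint
law.**

For the 4D torus of side `2S+1`, the Wilson measure `μ = wilsonMeasure r.ρ β`, a block size
`B ≥ 1` and a pin strength `s`, the ONE-LEVEL joint law of the fine field `U` and its
von Mises–Fisher-smeared straight-transporter block field `V` is

  `P' = (μ ⊗ Haar^{⊗E}).tilted (Σ_e s · Re tr r.ρ (V_e · h_e(U)⁻¹))`,
  `h_e(U) = BalabanAveraging.link (2S+1) B (BlockMean.rep 0) U e`.

With the vMF one-link law `ν = Haar.tilted (s · Re tr r.ρ)` (a probability measure) and the honest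
product `Q = μ ⊗ ν^{⊗E}`, we prove `P' = Q.map Ψ` for the "unshear" `Ψ(U, W) = (U, e ↦ W_e · h_e(U))`.

## Proof

Abstract fact (`OneLevelLaw.tilted_prod_shear_eq_map`): for a probability measure `μ`, an s-finite
`π`, a jointly measurable shear `g : X → Y → Y` with `π.map (g x) = π` for all `x` and a jointly
measurable fibrewise left inverse `gi` (`gi x (g x y) = y`), and a measurable `ψ`,

  `(μ ⊗ π).tilted (ψ ∘ g) = (μ ⊗ π.tilted ψ).map ((x, y) ↦ (x, gi x y))`:

the skew product `T(x, y) = (x, g x y)` preserves `μ ⊗ π` (`MeasurePreserving.skew_product`), so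
`((μ ⊗ π).tilted (ψ ∘ snd ∘ T)).map T = (μ ⊗ π).tilted (ψ ∘ snd) = μ ⊗ π.tilted ψ`
(`JointMarginal.map_tilted_comp`, `JointMarginal.tilted_prod_snd`), and the skew product by `gi`
cancels `T` (`Measure.map_map`, `Measure.map_id`).

Application: `g U V = e ↦ V_e · h_e(U)⁻¹` is measurable (`BalabanAveraging.measurable_link`; second
countability of `G` from the faithful representation `r`) and preserves `Haar^{⊗E}` by RIGHT
invariance of the Haar probability measure (`haarProbability.instIsMulRightInvariant`,
`measurePreserving_pi`, `measurePreserving_mul_right`); `gi U W = e ↦ W_e · h_e(U)`; and the product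
of Haar measures tilted by the one-link sum `ψ(W) = Σ_e s · Re tr r.ρ (W_e)` is the product of the
tilted factors (`GibbsSparseEfronStein.tilted_pi_sum_eq_pi_tilted`).  The vMF law is a probability
measure by `isProbabilityMeasure_tilted` and `integrable_exp_trace_re`; the Wilson measure by
`isProbabilityMeasure_wilsonMeasure`.
-/

noncomputable section

open MeasureTheory ProbabilityTheory
open Literature.MathematicalPhysics.QuantumFieldTheory

namespace Summit.QuantumFields.YangMills.Theorems.SusceptibilityToPoincare.RgVarianceCascade

namespace OneLevelLaw

/-! ### Abstract measure theory: a sheared tilt of a product is the image of an honest product -/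

section Abstract

variable {X Y : Type*} [MeasurableSpace X] [MeasurableSpace Y]

/-- **A product tilted along a fibrewise measure-preserving invertible shear is the image of the
honest product.**  Let `μ` be a probability measure and `π` s-finite, `g : X → Y → Y` jointly
measurable with `π.map (g x) = π` for all `x`, `gi` a jointly measurable fibrewise left inverse
(`gi x (g x y) = y`) and `ψ : Y → ℝ` measurable.  Then
`(μ ⊗ π).tilted ((x, y) ↦ ψ (g x y)) = (μ ⊗ π').map ((x, y) ↦ (x, gi x y))` whenever
`π.tilted ψ = π'`: the skew product `T(x, y) = (x, g x y)` preserves `μ ⊗ π`, carries the tilt to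
`ψ ∘ snd` (`JointMarginal.map_tilted_comp`, `JointMarginal.tilted_prod_snd`), and is cancelled by
the skew product by `gi`. [folklore] -/
theorem tilted_prod_shear_eq_map {μ : Measure X} {π : Measure Y} [IsProbabilityMeasure μ]
    [SFinite π] {g : X → Y → Y} (hgm : Measurable (Function.uncurry g))
    (hg : ∀ x, π.map (g x) = π) {gi : X → Y → Y} (hgim : Measurable (Function.uncurry gi))
    (hgi : ∀ x y, gi x (g x y) = y) {ψ : Y → ℝ} (hψm : Measurable ψ) {π' : Measure Y}
    (hπ' : π.tilted ψ = π') :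
    ((μ.prod π).tilted fun ω => ψ (g ω.1 ω.2)) =
      (μ.prod π').map fun ω : X × Y => (ω.1, gi ω.1 ω.2) := by
  subst hπ'
  -- the skew product preserves the product measure
  have hT : MeasurePreserving (fun ω : X × Y => (ω.1, g ω.1 ω.2)) (μ.prod π) (μ.prod π) :=
    (MeasurePreserving.id μ).skew_product hgm (ae_of_all _ hg)
  -- and carries the sheared tilt to the tilt of the second factor
  have key : (((μ.prod π).tilted fun ω => ψ (g ω.1 ω.2)).map fun ω : X × Y => (ω.1, g ω.1 ω.2)) =
      μ.prod (π.tilted ψ) :=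
    (JointMarginal.map_tilted_comp hT (ψ := fun ω : X × Y => ψ ω.2)
      (hψm.comp measurable_snd)).trans (JointMarginal.tilted_prod_snd μ π hψm)
  -- the skew product by `g` is cancelled by the skew product by `gi`
  have hTi : Measurable fun ω : X × Y => (ω.1, gi ω.1 ω.2) := measurable_fst.prodMk hgim
  rw [← key, Measure.map_map hTi hT.measurable, show (fun ω : X × Y => (ω.1, gi ω.1 ω.2)) ∘
    (fun ω : X × Y => (ω.1, g ω.1 ω.2)) = id from funext fun ω => Prod.ext rfl (hgi ω.1 ω.2),
    Measure.map_id]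

end Abstract

/-! ### The torus: the one-level shear by the straight transporters -/

section Torus

variable {G : Type} [Group G] [TopologicalSpace G] [IsTopologicalGroup G] [CompactSpace G]
  [MeasurableSpace G] [BorelSpace G]

omit [CompactSpace G] in
/-- The one-level shear `(U, V) ↦ e ↦ V_e · h_e(U)⁻¹` by the straight transporters of the fine
field (block size `B`, torus of side `2S+1`) is jointly measurable. [folklore] -/
theorem measurable_skew [SecondCountableTopology G] (S B : ℕ) [NeZero B] :
    Measurable fun ω : GaugeConfig 4 (2 * S + 1) G ×
        GaugeConfig 4 (BalabanAveraging.blockSide (2 * S + 1) B) G =>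
      fun e : Edge 4 (BalabanAveraging.blockSide (2 * S + 1) B) =>
        ω.2 e * (BalabanAveraging.link (2 * S + 1) B (BalabanAveraging.BlockMean.rep 0) ω.1 e)⁻¹ := by
  refine measurable_pi_lambda _ fun e => ?_
  have hl := BalabanAveraging.measurable_link (d := 4) (N := 2 * S + 1) (b := B) (G := G)
    (BalabanAveraging.BlockMean.rep 0)
  fun_prop

omit [CompactSpace G] in
/-- The one-level unshear `(U, W) ↦ e ↦ W_e · h_e(U)` by the straight transporters of the fine
field (block size `B`, torus of side `2S+1`) is jointly measurable. [folklore] -/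
theorem measurable_unskew [SecondCountableTopology G] (S B : ℕ) [NeZero B] :
    Measurable fun ω : GaugeConfig 4 (2 * S + 1) G ×
        GaugeConfig 4 (BalabanAveraging.blockSide (2 * S + 1) B) G =>
      fun e : Edge 4 (BalabanAveraging.blockSide (2 * S + 1) B) =>
        ω.2 e * BalabanAveraging.link (2 * S + 1) B (BalabanAveraging.BlockMean.rep 0) ω.1 e := by
  refine measurable_pi_lambda _ fun e => ?_
  have hl := BalabanAveraging.measurable_link (d := 4) (N := 2 * S + 1) (b := B) (G := G)
    (BalabanAveraging.BlockMean.rep 0)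
  fun_prop

/-- For a fixed fine field the one-level shear preserves the product Haar measure of the coarse
links (right invariance of the Haar probability measure of the compact group, coordinatewise:
`measurePreserving_pi`, `measurePreserving_mul_right`). [folklore] -/
theorem map_skew_pi (S B : ℕ) [NeZero B] (U : GaugeConfig 4 (2 * S + 1) G) :
    (Measure.pi fun _ : Edge 4 (BalabanAveraging.blockSide (2 * S + 1) B) => haarProbability G).map
      (fun (V : GaugeConfig 4 (BalabanAveraging.blockSide (2 * S + 1) B) G)
          (e : Edge 4 (BalabanAveraging.blockSide (2 * S + 1) B)) =>
        V e * (BalabanAveraging.link (2 * S + 1) B (BalabanAveraging.BlockMean.rep 0) U e)⁻¹) =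
    Measure.pi fun _ : Edge 4 (BalabanAveraging.blockSide (2 * S + 1) B) => haarProbability G :=
  (measurePreserving_pi (fun _ => haarProbability G) (fun _ => haarProbability G)
    (f := fun (e : Edge 4 (BalabanAveraging.blockSide (2 * S + 1) B)) (x : G) =>
      x * (BalabanAveraging.link (2 * S + 1) B (BalabanAveraging.BlockMean.rep 0) U e)⁻¹)
    fun _ => measurePreserving_mul_right (haarProbability G) _).map_eq

/-- **A product of Haar probability measures tilted by a one-link sum is the product of the
tilted (von Mises–Fisher) one-link laws**: `(Haar^{⊗ι}).tilted (W ↦ Σ_i φ(W_i)) = (Haar.tilted φ)^{⊗ι}`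
(`GibbsSparseEfronStein.tilted_pi_sum_eq_pi_tilted`). [folklore] -/
theorem pi_haar_tilted_sum (ι : Type*) [Fintype ι] (φ : G → ℝ) :
    (Measure.pi fun _ : ι => haarProbability G).tilted (fun W => ∑ i, φ (W i)) =
      Measure.pi fun _ : ι => (haarProbability G).tilted φ :=
  GibbsSparseEfronStein.tilted_pi_sum_eq_pi_tilted (fun _ : ι => haarProbability G) fun _ => φ

omit [IsTopologicalGroup G] [CompactSpace G] in
/-- The one-link sum `ψ(W) = Σ_e s · Re tr r.ρ (W_e)` is measurable (product σ-algebra; `r.ρ`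
continuous). [folklore] -/
theorem measurable_linkSum (r : LatticeRep G) (s : ℝ) (ι : Type*) [Fintype ι] :
    Measurable fun W : ι → G => ∑ i, s * (r.ρ (W i)).trace.re :=
  Finset.measurable_sum _ fun i _ => measurable_const.mul
    ((continuous_trace_re r.ρ r.continuous).measurable.comp (measurable_pi_apply i))

end Torus

end OneLevelLaw

/-! ### The registered stub -/

/-- `stub_oneLevelLaw_eq_map` — **N1, the noise representation of the one-level joint law**.
For EVERY compact `G`, lattice representation `r`, real `β`, block size `B ≥ 1`, pin strength `s`
and side `2S+1`: the von Mises–Fisher one-link law `ν = Haar.tilted (s · Re tr r.ρ)` is a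
probability measure (`isProbabilityMeasure_tilted`, `integrable_exp_trace_re`), and the one-level
joint law `(μ_{β,S} ⊗ Haar^{⊗E}).tilted (Σ_e s Re tr r.ρ (V_e (link U e)⁻¹))` is the image of the
honest product `μ_{β,S} ⊗ ν^{⊗E}` under the unshear `(U, W) ↦ (U, e ↦ W_e · link U e)`.  Instance of
`OneLevelLaw.tilted_prod_shear_eq_map` with the shear by the straight transporters
(`OneLevelLaw.measurable_skew`, `OneLevelLaw.map_skew_pi`: right invariance of Haar), its inverse
(`OneLevelLaw.measurable_unskew`, `inv_mul_cancel_right`), the measurable one-link sum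
(`OneLevelLaw.measurable_linkSum`) and the factorisation of the tilted product
(`OneLevelLaw.pi_haar_tilted_sum`); `μ_{β,S}` is a probability measure by
`isProbabilityMeasure_wilsonMeasure`. [folklore] -/
theorem stub_oneLevelLaw_eq_map :
    ∀ (G : Type) [Group G] [TopologicalSpace G] [IsTopologicalGroup G] [CompactSpace G]
      [MeasurableSpace G] [BorelSpace G] (r : LatticeRep G) (β : ℝ) (B : ℕ) [NeZero B] (s : ℝ) (S : ℕ),
      IsProbabilityMeasure ((haarProbability G).tilted fun w : G => s * (r.ρ w).trace.re) ∧
      ((wilsonMeasure r.ρ β : Measure (GaugeConfig 4 (2 * S + 1) G)).prod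
          (Measure.pi fun _ : Edge 4 (BalabanAveraging.blockSide (2 * S + 1) B) => haarProbability G)).tilted
          (fun ω => ∑ e : Edge 4 (BalabanAveraging.blockSide (2 * S + 1) B),
            s * (r.ρ (ω.2 e * (BalabanAveraging.link (2 * S + 1) B
              (BalabanAveraging.BlockMean.rep 0) ω.1 e)⁻¹)).trace.re) =
      (((wilsonMeasure r.ρ β : Measure (GaugeConfig 4 (2 * S + 1) G)).prod
          (Measure.pi fun _ : Edge 4 (BalabanAveraging.blockSide (2 * S + 1) B) =>
            (haarProbability G).tilted fun w : G => s * (r.ρ w).trace.re)).map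
        (fun ω : GaugeConfig 4 (2 * S + 1) G × GaugeConfig 4 (BalabanAveraging.blockSide (2 * S + 1) B) G =>
          (ω.1, fun e => ω.2 e * BalabanAveraging.link (2 * S + 1) B
            (BalabanAveraging.BlockMean.rep 0) ω.1 e))) := by
  intro G _ _ _ _ _ _ r β B _ s S
  haveI : SecondCountableTopology G :=
    (r.continuous.isClosedEmbedding r.injective).isEmbedding.secondCountableTopology
  haveI := isProbabilityMeasure_wilsonMeasure (d := 4) (L := 2 * S + 1) (G := G) r.ρ r.continuous β
  refine ⟨isProbabilityMeasure_tilted (integrable_exp_trace_re r.ρ r.continuous s), ?_⟩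
  exact OneLevelLaw.tilted_prod_shear_eq_map
    (μ := (wilsonMeasure r.ρ β : Measure (GaugeConfig 4 (2 * S + 1) G)))
    (π := Measure.pi fun _ : Edge 4 (BalabanAveraging.blockSide (2 * S + 1) B) => haarProbability G)
    (g := fun (U : GaugeConfig 4 (2 * S + 1) G)
        (V : GaugeConfig 4 (BalabanAveraging.blockSide (2 * S + 1) B) G)
        (e : Edge 4 (BalabanAveraging.blockSide (2 * S + 1) B)) =>
      V e * (BalabanAveraging.link (2 * S + 1) B (BalabanAveraging.BlockMean.rep 0) U e)⁻¹)
    (OneLevelLaw.measurable_skew S B) (OneLevelLaw.map_skew_pi S B)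
    (gi := fun (U : GaugeConfig 4 (2 * S + 1) G)
        (W : GaugeConfig 4 (BalabanAveraging.blockSide (2 * S + 1) B) G)
        (e : Edge 4 (BalabanAveraging.blockSide (2 * S + 1) B)) =>
      W e * BalabanAveraging.link (2 * S + 1) B (BalabanAveraging.BlockMean.rep 0) U e)
    (OneLevelLaw.measurable_unskew S B)
    (fun U V => funext fun e => inv_mul_cancel_right _ _)
    (ψ := fun W : GaugeConfig 4 (BalabanAveraging.blockSide (2 * S + 1) B) G =>
      ∑ e : Edge 4 (BalabanAveraging.blockSide (2 * S + 1) B), s * (r.ρ (W e)).trace.re)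
    (OneLevelLaw.measurable_linkSum r s (Edge 4 (BalabanAveraging.blockSide (2 * S + 1) B)))
    (OneLevelLaw.pi_haar_tilted_sum (G := G) (Edge 4 (BalabanAveraging.blockSide (2 * S + 1) B))
      fun w : G => s * (r.ρ w).trace.re)

end Summit.QuantumFields.YangMills.Theorems.SusceptibilityToPoincare.RgVarianceCascade

end
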